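import Summits.HubbardSuperconductivity.HubbardSuperconductivity.Theorems.SgCorridor.Negative.AnchorFreezeModel

/-!
# `SgCorridor` — negative side, part 3/3: bounds for the gauged torus `H_g(L,U)`

Continuation of `AnchorFreezeModel`. For the verbatim objects of route `ColourTheSpin`:

* `‖Δ_b‖ ≤ 4`, `[A_b, Δ_{b'}] = 0`, `A_b Δ_b A_b = 0`, hence (`eucNorm_PQ_mulVec_sq_le`)
  `‖Δ^g v‖² ≤ 16|Bond| ‖v‖² + 32|Bond| ‖v‖ Σ_b ‖E_b v‖` — the gauge-invariant pair field has no
  long-range part beyond the electric excitation;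
* `|Re⟨v,(hop+hop†)v⟩| ≤ 8|Bond| ‖v‖²`; `H_g` Hermitian; the expansion of `Re⟨v, H_g v⟩`;
* ENERGY SANDWICH: `Re⟨v,H_g v⟩ ≥ -8|Bond|‖v‖² + g² Σ_b ‖E_b v‖²` and, for the link-constant trial
  state `τ`, `Re⟨τ,H_g τ⟩ ≤ (8|Bond| + UL² + 2L²/g²)‖τ‖²` (NO electric energy, uniformly in `g`).

Refuter crux-attack 2026-08-17.
-/

-- `HubbardSuperconductivity.HubbardSuperconductivity` is the mandated Summit/Sub namespace (D-0017).
set_option linter.dupNamespace false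

noncomputable section

namespace Summit.HubbardSuperconductivity.HubbardSuperconductivity.Theorems

namespace SgAnchorFreeze

open Literature.MathematicalPhysics.QuantumLattice Literature.Hubbard Matrix Finset
open scoped Kronecker ComplexOrder

-- `DecidableEq (F L × K L)` exceeds the default instance size bound (a product with a function type
-- over a product); raise it here (the Model section of part 2 keeps the route file's defaults).
set_option synthInstance.maxSize 1024

section ModelLemmas

variable (L : ℕ)

/-- `|(ερ(k_b))_{στ}| ≤ 1`. [folklore] -/
theorem norm_pairD_le (b : GaugedHubbard.Bond L) (σ τ : Fin 2) (k : K L) : ‖pairD L b σ τ k‖ ≤ 1 := by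
  unfold pairD
  split_ifs
  · exact norm_rQ_le _ _ _
  · rw [norm_neg]; exact norm_rQ_le _ _ _

/-- The pair weight on bond `b` ignores the other links. [folklore] -/
theorem pairD_update_of_ne {b b' : GaugedHubbard.Bond L} (h : b ≠ b') (σ τ : Fin 2) (k : K L) (u : Q) :
    pairD L b σ τ (Function.update k b' u) = pairD L b σ τ k := by
  simp only [pairD, Function.update_of_ne h]

/-- The pair weight on bond `b` has zero mean over the value of link `b`. [folklore] -/
theorem sum_pairD_update (b : GaugedHubbard.Bond L) (σ τ : Fin 2) (k : K L) :
    ∑ u : Q, pairD L b σ τ (Function.update k b u) = 0 := by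
  simp only [pairD, Function.update_self]
  split_ifs
  · exact sum_rQ 1 τ
  · rw [Finset.sum_neg_distrib, sum_rQ, neg_zero]

variable [NeZero L]

/-- `‖P_b w‖ ≤ 4 ‖w‖`. [folklore] -/
theorem eucNorm_Pb_mulVec_le (b : GaugedHubbard.Bond L) (w : F L × K L → ℂ) :
    eucNorm (Pb L b *ᵥ w) ≤ 4 * eucNorm w := by
  have hT : ∀ σ τ : Fin 2, eucNorm ((Matrix.kroneckerMap (· * ·)
      (annihilation (orb b.1 σ) * annihilation (orb (b.1.shift b.2) τ))
      (Matrix.diagonal (pairD L b σ τ))) *ᵥ w) ≤ 1 * eucNorm w := fun σ τ =>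
    eucNorm_kron_diagonal_mulVec_le zero_le_one _ _ (eucNorm_ann_ann_mulVec_le _ _)
      (norm_pairD_le L b σ τ) w
  unfold Pb
  rw [smul_mulVec, eucNorm_smul]
  have hc : ‖(if b.2 = 0 then (1 : ℂ) else -1)‖ = 1 := by split_ifs <;> simp
  rw [hc, one_mul]
  simp only [Fin.sum_univ_two, add_mulVec]
  have h00 := hT 0 0; have h01 := hT 0 1; have h10 := hT 1 0; have h11 := hT 1 1
  calc _ ≤ _ := eucNorm_add_le _ _
    _ ≤ _ := add_le_add (eucNorm_add_le _ _) (eucNorm_add_le _ _)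
    _ ≤ (1 * eucNorm w + 1 * eucNorm w) + (1 * eucNorm w + 1 * eucNorm w) :=
        add_le_add (add_le_add h00 h01) (add_le_add h10 h11)
    _ = 4 * eucNorm w := by ring

/-- `Δ_{b'}` commutes with the average over a different link `b`. [folklore] -/
theorem lavg_Pb_mulVec_of_ne {b b' : GaugedHubbard.Bond L} (h : b ≠ b') (w : F L × K L → ℂ) :
    lavg b (Pb L b' *ᵥ w) = Pb L b' *ᵥ lavg b w := by
  unfold Pb
  rw [smul_mulVec, smul_mulVec, lavg_smul]
  congr 1
  simp only [sum_mulVec, lavg_sum]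
  refine Finset.sum_congr rfl fun σ _ => Finset.sum_congr rfl fun τ _ => ?_
  exact lavg_kron_diagonal_mulVec_of_indep b _ _ (fun k u => pairD_update_of_ne L (Ne.symm h) σ τ k u) w

/-- `A_b Δ_b A_b = 0`: the bond pair field maps flux-free-on-`b` vectors to `b`-excited vectors. [folklore] -/
theorem lavg_Pb_mulVec_lavg (b : GaugedHubbard.Bond L) (w : F L × K L → ℂ) :
    lavg b (Pb L b *ᵥ lavg b w) = 0 := by
  unfold Pb
  rw [smul_mulVec, lavg_smul]
  simp only [sum_mulVec, lavg_sum]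
  rw [Finset.sum_eq_zero, smul_zero]
  intro σ _
  refine Finset.sum_eq_zero fun τ _ => ?_
  exact lavg_kron_diagonal_mulVec_lavg_eq_zero b _ _ (sum_pairD_update L b σ τ) w

/-- **The pair field has no long-range part beyond the electric excitation.** [folklore] -/
theorem eucNorm_PQ_mulVec_sq_le (v : F L × K L → ℂ) :
    eucNorm (PQ L *ᵥ v) ^ 2 ≤
      16 * Fintype.card (GaugedHubbard.Bond L) * eucNorm v ^ 2 +
        32 * Fintype.card (GaugedHubbard.Bond L) * eucNorm v * ∑ b, eucNorm (v - lavg b v) := by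
  have h := pair_sum_bound (C := 4) (by norm_num) (Pb L) (eucNorm_Pb_mulVec_le L)
    (fun b b' hbb' w => lavg_Pb_mulVec_of_ne L hbb' w) (lavg_Pb_mulVec_lavg L) v
  unfold PQ
  calc _ ≤ _ := h
    _ = _ := by ring

/-- The hopping is bounded by the number of its terms. [folklore] -/
theorem norm_star_dotProduct_hopQ_mulVec_le (v : F L × K L → ℂ) :
    ‖star v ⬝ᵥ (hopQ L *ᵥ v)‖ ≤ 4 * Fintype.card (GaugedHubbard.Bond L) * eucNorm v ^ 2 := by
  unfold hopQ
  simp only [sum_mulVec, dotProduct_sum]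
  have hterm : ∀ (b : GaugedHubbard.Bond L) (σ τ : Fin 2),
      ‖star v ⬝ᵥ ((Matrix.kroneckerMap (· * ·) (creation (orb b.1 σ) * annihilation (orb (b.1.shift b.2) τ))
        (Matrix.diagonal fun k : GaugedHubbard.Bond L → Fin 2 × ZMod 4 => rQ (k b) σ τ)) *ᵥ v)‖ ≤
        eucNorm v ^ 2 := by
    intro b σ τ
    refine (norm_star_dotProduct_le _ _).trans ?_
    have h := eucNorm_kron_diagonal_mulVec_le zero_le_one _
      (fun k : GaugedHubbard.Bond L → Fin 2 × ZMod 4 => rQ (k b) σ τ)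
      (eucNorm_cre_ann_mulVec_le (orb b.1 σ) (orb (b.1.shift b.2) τ)) (fun k => norm_rQ_le _ _ _) v
    rw [one_mul] at h
    calc eucNorm v * _ ≤ eucNorm v * eucNorm v := mul_le_mul_of_nonneg_left h (eucNorm_nonneg v)
      _ = eucNorm v ^ 2 := (sq _).symm
  calc _ ≤ ∑ b, ‖∑ σ, ∑ τ, star v ⬝ᵥ ((Matrix.kroneckerMap (· * ·)
          (creation (orb b.1 σ) * annihilation (orb (b.1.shift b.2) τ))
          (Matrix.diagonal fun k : GaugedHubbard.Bond L → Fin 2 × ZMod 4 => rQ (k b) σ τ)) *ᵥ v)‖ :=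
        norm_sum_le _ _
    _ ≤ ∑ b : GaugedHubbard.Bond L, (4 : ℝ) * eucNorm v ^ 2 := by
        refine Finset.sum_le_sum fun b _ => (norm_sum_le _ _).trans ?_
        calc _ ≤ ∑ σ : Fin 2, (2 : ℝ) * eucNorm v ^ 2 := by
              refine Finset.sum_le_sum fun σ _ => (norm_sum_le _ _).trans ?_
              calc _ ≤ ∑ τ : Fin 2, eucNorm v ^ 2 := Finset.sum_le_sum fun τ _ => hterm b σ τ
                _ = 2 * eucNorm v ^ 2 := by simp [two_mul]
          _ = 4 * eucNorm v ^ 2 := by simp; ring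
    _ = 4 * Fintype.card (GaugedHubbard.Bond L) * eucNorm v ^ 2 := by
        rw [Finset.sum_const, Finset.card_univ, nsmul_eq_mul]; ring

/-- `|Re ⟨v, (hop + hop†) v⟩| ≤ 8 |Bond| ‖v‖²`. [folklore] -/
theorem abs_re_hop_le (v : F L × K L → ℂ) :
    |(star v ⬝ᵥ ((hopQ L + (hopQ L)ᴴ) *ᵥ v)).re| ≤
      8 * Fintype.card (GaugedHubbard.Bond L) * eucNorm v ^ 2 := by
  rw [add_mulVec, dotProduct_add, Complex.add_re]
  have h1 := norm_star_dotProduct_hopQ_mulVec_le L v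
  have h2 : ‖star v ⬝ᵥ ((hopQ L)ᴴ *ᵥ v)‖ ≤ 4 * Fintype.card (GaugedHubbard.Bond L) * eucNorm v ^ 2 := by
    have : star v ⬝ᵥ ((hopQ L)ᴴ *ᵥ v) = star (star v ⬝ᵥ (hopQ L *ᵥ v)) := by
      rw [dotProduct_mulVec, vecMul_conjTranspose, star_star, star_dotProduct]
    rw [this, norm_star]
    exact h1
  calc _ ≤ |(star v ⬝ᵥ (hopQ L *ᵥ v)).re| + |(star v ⬝ᵥ ((hopQ L)ᴴ *ᵥ v)).re| := abs_add_le _ _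
    _ ≤ ‖star v ⬝ᵥ (hopQ L *ᵥ v)‖ + ‖star v ⬝ᵥ ((hopQ L)ᴴ *ᵥ v)‖ :=
        add_le_add (Complex.abs_re_le_norm _) (Complex.abs_re_le_norm _)
    _ ≤ _ := add_le_add h1 h2
    _ = _ := by ring

end ModelLemmas

/-! ### Diagonal bookkeeping, Hermiticity, energy bounds -/

-- `DecidableEq (F L × K L)` exceeds the default instance size bound (it is a product with a
-- function type over a product); raise it for the proof sections (the Model section above keeps the
-- defaults of the Theses file, so that `sgAnchorOrder_iff` stays `Iff.rfl`).
set_option synthInstance.maxSize 1024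

section Energy

/-- `Re ⟨v, diag f v⟩ = Σᵢ Re fᵢ |vᵢ|²`. [folklore] -/
theorem re_star_dotProduct_diagonal_mulVec {n : Type*} [Fintype n] [DecidableEq n] (f : n → ℂ) (v : n → ℂ) :
    (star v ⬝ᵥ (diagonal f *ᵥ v)).re = ∑ i, (f i).re * ‖v i‖ ^ 2 := by
  simp only [dotProduct, mulVec_diagonal, Pi.star_apply, Complex.re_sum]
  refine Finset.sum_congr rfl fun i _ => ?_
  have : star (v i) * (f i * v i) = f i * (star (v i) * v i) := by ring
  rw [this, Complex.star_def, Complex.conj_mul', ← Complex.ofReal_pow, Complex.re_mul_ofReal]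

/-- `Re ⟨w, (Σ_x n_{x↑} n_{x↓}) w⟩ = Σ_s #doublons(s) · |w s|²` (generic vertex type, so that the
instance paths agree with the library's diagonal form). [folklore] -/
theorem re_star_dotProduct_dbl {Λ : Type*} [LinearOrder Λ] [Fintype Λ] (w : Fock (Orb Λ)) :
    (star w ⬝ᵥ ((∑ x : Λ, numberOp x 0 * numberOp x 1) *ᵥ w)).re =
      ∑ s, ((doublyOccupied s).card : ℝ) * ‖w s‖ ^ 2 := by
  rw [sum_numberOp_mul_numberOp_eq_diagonal, re_star_dotProduct_diagonal_mulVec]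
  simp only [Complex.natCast_re]

/-- The doublon count is Hermitian (generic vertex type). [folklore] -/
theorem dbl_isHermitian {Λ : Type*} [LinearOrder Λ] [Fintype Λ] :
    (∑ x : Λ, numberOp x 0 * numberOp x 1 : Matrix (Finset (Orb Λ)) (Finset (Orb Λ)) ℂ).IsHermitian := by
  rw [sum_numberOp_mul_numberOp_eq_diagonal]
  exact (isHermitian_diagonal_iff).2 fun s =>
    (star_natCast _ : star (((doublyOccupied s).card : ℕ) : ℂ) = _)

variable (L : ℕ)

/-- `|Bond L| = 2L²`. [folklore] -/
theorem card_bond : Fintype.card (GaugedHubbard.Bond L) = 2 * L ^ 2 := by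
  have hcT : Fintype.card (FermionTorus 2 L) = L ^ 2 := by simp [FermionTorus, Fintype.card_lex]
  rw [Fintype.card_prod, hcT, Fintype.card_fin]; ring

/-- The doublon count of the torus is Hermitian. [folklore] -/
theorem dblQ_isHermitian : (dblQ L).IsHermitian := dbl_isHermitian


/-- The trial state is fixed by every link average (no electric energy). [folklore] -/
theorem lavg_trialV (b : GaugedHubbard.Bond L) (s₀ : F L) : lavg b (trialV L s₀) = trialV L s₀ :=
  lavg_of_const b (fun s : F L => if s = s₀ then (1 : ℂ) else 0)

/-- The trial state is nonzero. [folklore] -/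
theorem trialV_ne_zero (s₀ : F L) : trialV L s₀ ≠ 0 := by
  intro h
  have := congrFun h (s₀, fun _ => ((0 : Fin 2), (0 : ZMod 4)))
  simp [trialV] at this

variable [NeZero L]

/-- `0 ≤ Re (magnetic weight) ≤ 2L²`. [folklore] -/
theorem magW_re_bounds (k : K L) :
    0 ≤ (magW L k).re ∧ (magW L k).re ≤ 2 * Fintype.card (FermionTorus 2 L) := by
  unfold magW
  rw [Complex.re_sum]
  have hx : ∀ x : FermionTorus 2 L,
      0 ≤ (1 - (rQ (mQ (mQ (mQ (k (x, 0)) (k (x.shift 0, 1))) (ivQ (k (x.shift 1, 0)))) (ivQ (k (x, 1)))) 0 0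
        + rQ (mQ (mQ (mQ (k (x, 0)) (k (x.shift 0, 1))) (ivQ (k (x.shift 1, 0)))) (ivQ (k (x, 1)))) 1 1) / 2).re ∧
      (1 - (rQ (mQ (mQ (mQ (k (x, 0)) (k (x.shift 0, 1))) (ivQ (k (x.shift 1, 0)))) (ivQ (k (x, 1)))) 0 0
        + rQ (mQ (mQ (mQ (k (x, 0)) (k (x.shift 0, 1))) (ivQ (k (x.shift 1, 0)))) (ivQ (k (x, 1)))) 1 1) / 2).re ≤ 2 := by
    intro x
    have ha := re_rQ_le (mQ (mQ (mQ (k (x, 0)) (k (x.shift 0, 1))) (ivQ (k (x.shift 1, 0)))) (ivQ (k (x, 1)))) 0 0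
    have hb := re_rQ_le (mQ (mQ (mQ (k (x, 0)) (k (x.shift 0, 1))) (ivQ (k (x.shift 1, 0)))) (ivQ (k (x, 1)))) 1 1
    rw [abs_le] at ha hb
    simp only [Complex.sub_re, Complex.one_re, Complex.div_ofNat_re, Complex.add_re]
    constructor <;> linarith [ha.1, ha.2, hb.1, hb.2]
  constructor
  · exact Finset.sum_nonneg fun x _ => (hx x).1
  · calc _ ≤ ∑ x : FermionTorus 2 L, (2 : ℝ) := Finset.sum_le_sum fun x _ => (hx x).2
      _ = 2 * Fintype.card (FermionTorus 2 L) := by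
          rw [Finset.sum_const, Finset.card_univ, nsmul_eq_mul]; ring

/-- Expansion of `Re ⟨v, H v⟩` into its four terms. [folklore] -/
theorem re_HQ_expand (U g : ℝ) (v : F L × K L → ℂ) :
    (star v ⬝ᵥ (HQ L U g *ᵥ v)).re =
      -(star v ⬝ᵥ ((hopQ L + (hopQ L)ᴴ) *ᵥ v)).re
        + U * ∑ k, ∑ s, ((doublyOccupied s).card : ℝ) * ‖v (s, k)‖ ^ 2
        + g ^ 2 * ∑ b, eucNorm (v - lavg b v) ^ 2
        + 1 / g ^ 2 * ∑ i, (magW L i.2).re * ‖v i‖ ^ 2 := by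
  have hU : (star v ⬝ᵥ ((dblQ L ⊗ₖ (1 : Matrix (K L) (K L) ℂ)) *ᵥ v)).re =
      ∑ k, ∑ s, ((doublyOccupied s).card : ℝ) * ‖v (s, k)‖ ^ 2 := by
    rw [← diagonal_one, star_dotProduct_kron_diagonal_mulVec, Complex.re_sum]
    refine Finset.sum_congr rfl fun k _ => ?_
    rw [one_mul, dblQ, re_star_dotProduct_dbl]
  have hM : (star v ⬝ᵥ (((1 : Matrix (F L) (F L) ℂ)) ⊗ₖ diagonal (magW L) *ᵥ v)).re =
      ∑ i, (magW L i.2).re * ‖v i‖ ^ 2 := by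
    have hvec : ((1 : Matrix (F L) (F L) ℂ) ⊗ₖ diagonal (magW L)) *ᵥ v = fun i => magW L i.2 * v i := by
      funext ⟨s, k⟩
      rw [one_kron_mulVec_apply, mulVec_diagonal]
    rw [hvec]
    simp only [dotProduct, Pi.star_apply, Complex.re_sum]
    refine Finset.sum_congr rfl fun i _ => ?_
    have : star (v i) * (magW L i.2 * v i) = magW L i.2 * (star (v i) * v i) := by ring
    rw [this, Complex.star_def, Complex.conj_mul', ← Complex.ofReal_pow, Complex.re_mul_ofReal]
  unfold HQ
  rw [add_mulVec, add_mulVec, add_mulVec, neg_mulVec]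
  simp only [smul_mulVec, dotProduct_add, dotProduct_neg, dotProduct_smul, smul_eq_mul,
    Complex.add_re, Complex.neg_re, Complex.re_ofReal_mul]
  rw [hU, hM, re_star_dotProduct_elOp]

/-- **Energy lower bound:** `Re ⟨v, H v⟩ ≥ -8|Bond| ‖v‖² + g² · (electric excitation)`. [folklore] -/
theorem re_HQ_lower {U g : ℝ} (hU : 0 ≤ U) (hg : 0 < g) (v : F L × K L → ℂ) :
    -(8 * Fintype.card (GaugedHubbard.Bond L)) * eucNorm v ^ 2 + g ^ 2 * ∑ b, eucNorm (v - lavg b v) ^ 2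
      ≤ (star v ⬝ᵥ (HQ L U g *ᵥ v)).re := by
  rw [re_HQ_expand]
  have h1 := abs_re_hop_le L v
  rw [abs_le] at h1
  have h2 : 0 ≤ U * ∑ k, ∑ s, ((doublyOccupied s).card : ℝ) * ‖v (s, k)‖ ^ 2 :=
    mul_nonneg hU (Finset.sum_nonneg fun k _ => Finset.sum_nonneg fun s _ => by positivity)
  have h3 : 0 ≤ 1 / g ^ 2 * ∑ i, (magW L i.2).re * ‖v i‖ ^ 2 :=
    mul_nonneg (by positivity) (Finset.sum_nonneg fun i _ =>
      mul_nonneg (magW_re_bounds L i.2).1 (sq_nonneg _))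
  linarith [h1.1, h1.2]

/-- **Energy of the trial state:** `Re ⟨τ, H τ⟩ ≤ (8|Bond| + U L² + 2L²/g²) ‖τ‖²` (no electric energy). [folklore] -/
theorem re_HQ_trial_le {U g : ℝ} (hU : 0 ≤ U) (hg : 0 < g) (s₀ : F L) :
    (star (trialV L s₀) ⬝ᵥ (HQ L U g *ᵥ trialV L s₀)).re ≤
      (8 * Fintype.card (GaugedHubbard.Bond L) + U * Fintype.card (FermionTorus 2 L)
        + 1 / g ^ 2 * (2 * Fintype.card (FermionTorus 2 L))) * eucNorm (trialV L s₀) ^ 2 := by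
  rw [re_HQ_expand]
  have h1 := abs_re_hop_le L (trialV L s₀)
  rw [abs_le] at h1
  have hel : ∑ b, eucNorm (trialV L s₀ - lavg b (trialV L s₀)) ^ 2 = 0 := by
    refine Finset.sum_eq_zero fun b _ => ?_
    rw [lavg_trialV, sub_self, eucNorm_zero]; ring
  have h2 : ∑ k, ∑ s, ((doublyOccupied s).card : ℝ) * ‖trialV L s₀ (s, k)‖ ^ 2 ≤
      Fintype.card (FermionTorus 2 L) * eucNorm (trialV L s₀) ^ 2 := by
    rw [NeubergerBound.eucNorm_sq_eq_sum, Fintype.sum_prod_type_right, Finset.mul_sum]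
    refine Finset.sum_le_sum fun k _ => ?_
    rw [Finset.mul_sum]
    refine Finset.sum_le_sum fun s _ => mul_le_mul_of_nonneg_right ?_ (sq_nonneg _)
    exact_mod_cast Finset.card_le_univ _
  have h3 : ∑ i, (magW L i.2).re * ‖trialV L s₀ i‖ ^ 2 ≤
      (2 * Fintype.card (FermionTorus 2 L)) * eucNorm (trialV L s₀) ^ 2 := by
    rw [NeubergerBound.eucNorm_sq_eq_sum, Finset.mul_sum]
    exact Finset.sum_le_sum fun i _ => mul_le_mul_of_nonneg_right (magW_re_bounds L i.2).2 (sq_nonneg _)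
  rw [hel, mul_zero, add_zero]
  have h2' := mul_le_mul_of_nonneg_left h2 hU
  have h3' := mul_le_mul_of_nonneg_left h3 (by positivity : (0 : ℝ) ≤ 1 / g ^ 2)
  nlinarith [h1.1, h1.2, h2', h3']

/-- The electric operator is Hermitian (real symmetric). [folklore] -/
theorem elOp_isHermitian {β : Type*} [Fintype β] [DecidableEq β] : (elOp β).IsHermitian := by
  apply Matrix.IsHermitian.ext
  intro k k'
  simp only [elOp, Matrix.sum_apply, Matrix.of_apply, star_sum]
  refine Finset.sum_congr rfl fun b _ => ?_
  have hiff : (k = Function.update k' b (k b)) ↔ (k' = Function.update k b (k' b)) := by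
    rw [Function.eq_update_iff, Function.eq_update_iff]
    constructor <;> rintro ⟨-, h⟩ <;> exact ⟨rfl, fun x hx => (h x hx).symm⟩
  by_cases h1 : k' = Function.update k b (k' b)
  · rw [if_pos (hiff.2 h1), if_pos h1]
    by_cases h2 : k b = k' b
    · rw [if_pos h2.symm, if_pos h2]; simp
    · rw [if_neg (Ne.symm h2), if_neg h2]; simp
  · rw [if_neg (fun h => h1 (hiff.1 h)), if_neg h1, star_zero]

/-- The magnetic weight is real. [folklore] -/
theorem magW_star (k : K L) : star (magW L k) = magW L k := by
  unfold magW
  rw [star_sum]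
  refine Finset.sum_congr rfl fun x _ => ?_
  have h := star_rQ_diag (mQ (mQ (mQ (k (x, 0)) (k (x.shift 0, 1))) (ivQ (k (x.shift 1, 0)))) (ivQ (k (x, 1))))
  rw [Complex.star_def] at h ⊢
  simp only [map_sub, map_one, map_div₀, map_ofNat, h]

/-- `H_g(L,U)` is Hermitian. [folklore] -/
theorem HQ_isHermitian (U g : ℝ) : (HQ L U g).IsHermitian := by
  unfold HQ
  refine (((Matrix.isHermitian_add_transpose_self _).neg.add ?_).add ?_).add ?_
  · exact GaugedHubbard.isHermitian_real_smul U
      (GaugedHubbard.isHermitian_kronecker (dblQ_isHermitian L) isHermitian_one)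
  · exact GaugedHubbard.isHermitian_real_smul _
      (GaugedHubbard.isHermitian_kronecker isHermitian_one elOp_isHermitian)
  · exact GaugedHubbard.isHermitian_real_smul _
      (GaugedHubbard.isHermitian_kronecker isHermitian_one ((isHermitian_diagonal_iff).2 (magW_star L)))

end Energy

end SgAnchorFreeze

end Summit.HubbardSuperconductivity.HubbardSuperconductivity.Theorems
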